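import Literature.AlgebraicGeometry.ModuliOfAbelianVarieties.Lan2013.Sec142to144IsogenyClasses
import Literature.IUT.LogThetaLattice.RemarksArithmetic
import HarnessLib

/-!
# [Lan2013] §1.4.2–§1.4.4 carpet — the DISCHARGES (theorem-only companion of `Sec142to144IsogenyClasses.lean`)

Topic `AlgebraicGeometry/ModuliOfAbelianVarieties/Lan2013`, namespace
`Literature.AlgebraicGeometry.ModuliOfAbelianVarieties.Lan2013.Sec142to144IsogenyClasses` (same as the carpet, so that each
`theorem X_holds : X` sits next to its fact `X`).  THEOREMS ONLY (D-0014 discharges; no `def`, no named fact, no `sorry`, no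
`instance`, no notation; squad TS RULING TS-1 «one theorem-only companion `<Stem>Holds.lean` per carpet»).  Every named fact of the
carpet [Lan2013PELCompactifications, §1.4.2–§1.4.4] is proved here from Mathlib and one tree theorem:

* `Lan2013_1423_pairing_holds` — Rem. 1.4.2.3 (p. 84), `e^{λ′}(V f x, V f y) = e^λ(x, r⁻¹y)`: bilinearity and `r r⁻¹ = 1`.
* `Lan2013_1423_nuCondition_holds` — Rem. 1.4.2.3 (p. 84), the `ν`-clause: take `h := c`.
* `Lan2013_1434_approximation_holds` (+ the `□`-load-bearing corollary `Lan2013_1434_approximation_box`, squad QA-5) — the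
  approximation `𝔸^{∞,□,×} = ℤ^×_(□),>0 · Ẑ^{□,×}` with uniqueness (proof of Prop. 1.4.3.4, pp. 85–86): existence by `r := Π_{q prime, e(q) ≠ 0} q^{e(q)}`
  and Mathlib's `padicValRat.zpow` ∕ `padicValRat.self` ∕ `padicValNat_primes`; uniqueness by the tree's ★
  `Literature.IUT.LogThetaLattice.Rat.eq_one_of_forall_padicValRat_eq_zero` («`ℚ_{>0} ∩ Ẑ^× = {1}`») applied to `r₁ / r₂`.
* `Lan2013_1439_span_fg_holds` — Rem. 1.4.3.9 (p. 87): `𝒪′·L` is spanned by the finitely many products `s·t` of generators.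
* `Lan2013_14311_heckeTranslate_holds` — Rem. 1.4.3.11 (pp. 87–88): `(x·h′)·g = (x·g)·(g⁻¹h′g)`.

Net effect: the carpet's five named facts are all discharged (a discharged fact stays a `def`; users' `(h : X)` are fed `X_holds`).

## References
* [Lan2013PELCompactifications] K.-W. Lan, *Arithmetic compactifications of PEL-type Shimura varieties*, LMS Monographs 36 (2013):
  Rem. 1.4.2.3 p. 84, Prop. 1.4.3.4 pp. 85–86, Rem. 1.4.3.9 p. 87, Rem. 1.4.3.11 pp. 87–88.
-/

noncomputable section

open Pointwise

namespace Literature.AlgebraicGeometry.ModuliOfAbelianVarieties.Lan2013.Sec142to144IsogenyClasses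

universe u v

/-! ## Rem. 1.4.2.3 -/

/-- **Rem. 1.4.2.3, the pairing identity, holds**: from `λ = r·f^∨λ′f` and the adjointness `e_A(x, f^∨y′) = e_{A′}(fx, y′)`,
`e^{λ′}(fx, fy) = e_A(x, f^∨λ′f y) = e_A(x, λ(r⁻¹y))`. [cite: Lan2013PELCompactifications, Rem. 1.4.2.3 (p. 84)] -/
theorem Lan2013_1423_pairing_holds : Lan2013_1423_pairing.{u, v} := by
  intro K _ V W V' W' T _ _ _ _ _ _ _ _ _ _ eA eA' f fdual hadj lam lam' r hlam x y
  subst hlam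
  simp only [LinearMap.map_smul, LinearMap.smul_apply, LinearMap.coe_comp, Function.comp_apply, hadj]
  rw [smul_smul, Units.mul_inv, one_smul]

/-- **Rem. 1.4.2.3, the `ν`-clause is forced, holds**: with `ν(c) = ν(α̂′)⁻¹ r⁻¹ ν(α̂)` and `c ∈ H`, the element `h := c` witnesses
`ν(α̂′)⁻¹ν(α̂) = ν(h)·r`. [cite: Lan2013PELCompactifications, Rem. 1.4.2.3 (p. 84)] -/
theorem Lan2013_1423_nuCondition_holds : Lan2013_1423_nuCondition.{u, v} := by
  intro G U _ _ ν H c a a' r hν hc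
  refine ⟨c, hc, ?_⟩
  rw [hν]
  group
  simp [mul_comm, mul_left_comm]

/-! ## The approximation `𝔸^{∞,□,×} = ℤ^×_(□),>0 · Ẑ^{□,×}` (proof of Prop. 1.4.3.4) -/

/-- `v_p` of a finite product of nonzero rationals is the sum of the `v_p`. [folklore] -/
private theorem padicValRat_finset_prod {p : ℕ} [Fact p.Prime] {ι : Type*} (s : Finset ι) (f : ι → ℚ)
    (hf : ∀ i ∈ s, f i ≠ 0) : padicValRat p (∏ i ∈ s, f i) = ∑ i ∈ s, padicValRat p (f i) := by
  classical
  induction s using Finset.induction_on with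
  | empty => simp
  | insert a s ha ih =>
    rw [Finset.prod_insert ha, Finset.sum_insert ha,
      padicValRat.mul (hf a (Finset.mem_insert_self a s))
        (Finset.prod_ne_zero_iff.mpr fun i hi => hf i (Finset.mem_insert_of_mem hi)),
      ih fun i hi => hf i (Finset.mem_insert_of_mem hi)]

/-- `v_p(q^k) = k` for primes `p = q`, `= 0` for primes `p ≠ q`. [folklore] -/
private theorem padicValRat_prime_zpow {p q : ℕ} [hp : Fact p.Prime] (hq : q.Prime) (k : ℤ) :
    padicValRat p ((q : ℚ) ^ k) = if p = q then k else 0 := by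
  rw [padicValRat.zpow, ← padicValRat_of_nat]
  split_ifs with h
  · subst h
    rw [padicValNat_self]
    simp
  · haveI : Fact q.Prime := ⟨hq⟩
    rw [padicValNat_primes h]
    simp

/-- Two positive rationals with the same valuation at every prime are equal (from the tree's ★
`Rat.eq_one_of_forall_padicValRat_eq_zero` applied to the quotient). [folklore] -/
private theorem eq_of_forall_padicValRat_eq {r₁ r₂ : ℚ} (h₁ : 0 < r₁) (h₂ : 0 < r₂)
    (h : ∀ p : ℕ, p.Prime → padicValRat p r₁ = padicValRat p r₂) : r₁ = r₂ := by
  have hq : r₁ / r₂ = 1 := by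
    refine Literature.IUT.LogThetaLattice.Rat.eq_one_of_forall_padicValRat_eq_zero _ (div_pos h₁ h₂) fun p hp => ?_
    haveI : Fact p.Prime := ⟨hp⟩
    rw [padicValRat.div h₁.ne' h₂.ne', h p hp, sub_self]
  rwa [div_eq_one_iff_eq h₂.ne'] at hq

/-- **The approximation with uniqueness (ED. 1 form) holds**: every finitely supported exponent vector `e` (vanishing on `□`) is the
valuation vector of exactly one positive rational, namely `Π_{q prime, e(q) ≠ 0} q^{e(q)}`.
[cite: Lan2013PELCompactifications, Prop. 1.4.3.4, proof (pp. 85–86)] -/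
theorem Lan2013_1434_approximation_holds : Lan2013_1434_approximation := by
  intro box e hfin _hbox
  classical
  -- the primes in the support
  set s : Finset ℕ := hfin.toFinset.filter Nat.Prime with hs
  have hmem : ∀ q : ℕ, q ∈ s ↔ e q ≠ 0 ∧ q.Prime := fun q => by
    simp [hs, Set.Finite.mem_toFinset, Function.mem_support]
  set r : ℚ := ∏ q ∈ s, (q : ℚ) ^ e q with hr
  have hfac_pos : ∀ q ∈ s, (0 : ℚ) < (q : ℚ) ^ e q := fun q hq =>
    zpow_pos (by exact_mod_cast ((hmem q).mp hq).2.pos) _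
  have hrpos : 0 < r := Finset.prod_pos hfac_pos
  have hval : ∀ p : ℕ, p.Prime → padicValRat p r = e p := by
    intro p hp
    haveI : Fact p.Prime := ⟨hp⟩
    rw [hr, padicValRat_finset_prod s _ fun q hq => (hfac_pos q hq).ne']
    rw [Finset.sum_congr rfl fun q hq => padicValRat_prime_zpow ((hmem q).mp hq).2 (e q)]
    rw [Finset.sum_ite_eq]
    split_ifs with hps
    · rfl
    · -- `p ∉ s` with `p` prime means `e p = 0`
      by_contra hne
      exact hps ((hmem p).mpr ⟨fun h0 => hne (by rw [h0]), hp⟩)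
  refine ⟨r, ⟨hrpos, hval⟩, fun r' ⟨hr'pos, hval'⟩ => ?_⟩
  exact eq_of_forall_padicValRat_eq hr'pos hrpos fun p hp => by rw [hval' p hp, hval p hp]

/-- **The approximation with uniqueness, `□`-load-bearing form** (squad QA T-ref4 QA-5: the shape in which the proof of Prop. 1.4.3.4
uses it — «there exists a unique `r ∈ ℤ^×_(□),>0` such that …», p. 86): for a finitely supported exponent vector `e` vanishing on `□`
there is a unique `r ∈ ℤ^×_(□),>0` (`IsPosUnitZloc box r`) with `v_p(r) = e(p)` for every prime `p ∉ □`.  A THEOREM (no new fact: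
it is `Lan2013_1434_approximation_holds` plus the case split `p ∈ □ ∕ p ∉ □`; the gate's review of the withdrawn ED. 2 (p848272)
asked for exactly this instead of a second `def`). [cite: Lan2013PELCompactifications, Prop. 1.4.3.4, proof (pp. 85–86)] -/
theorem Lan2013_1434_approximation_box (box : Set ℕ) (e : ℕ → ℤ) (hfin : (Function.support e).Finite)
    (hbox : ∀ p ∈ box, e p = 0) :
    ∃! r : ℚ, IsPosUnitZloc box r ∧ ∀ p : ℕ, p.Prime → p ∉ box → padicValRat p r = e p := by
  obtain ⟨r, ⟨hrpos, hval⟩, huniq⟩ := Lan2013_1434_approximation_holds box e hfin hbox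
  refine ⟨r, ⟨⟨hrpos, fun p hp hpp => by rw [hval p hpp, hbox p hp]⟩, fun p hp _ => hval p hp⟩, ?_⟩
  rintro r' ⟨⟨hr'pos, hr'box⟩, hr'val⟩
  refine huniq r' ⟨hr'pos, fun p hp => ?_⟩
  by_cases hpb : p ∈ box
  · rw [hr'box p hpb hp, hbox p hpb]
  · exact hr'val p hp hpb

/-! ## Rem. 1.4.3.9 -/

/-- **Rem. 1.4.3.9, first claim, holds**: if `𝒪′ = ℤ⟨S⟩` and `L = ℤ⟨T⟩` with `S`, `T` finite, then `𝒪′·L = ℤ⟨s·t : s ∈ S, t ∈ T⟩`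
(the products are `ℤ`-bilinear), so `𝒪′·L` is finitely generated. [cite: Lan2013PELCompactifications, Rem. 1.4.3.9 (p. 87)] -/
theorem Lan2013_1439_span_fg_holds : Lan2013_1439_span_fg.{u, v} := by
  intro B V _ _ _ O' L hO hL
  classical
  obtain ⟨S, hS⟩ := hO
  obtain ⟨T, hT⟩ := hL
  -- the candidate generating set: all products `s • t`
  let P : Submodule ℤ V := Submodule.span ℤ ((S ×ˢ T).image fun st => st.1 • st.2 : Finset V)
  have hle : O' • L ≤ P := by
    rw [Submodule.smul_le]
    intro b hb n hn
    rw [← hS] at hb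
    rw [← hT] at hn
    -- bilinear closure: induct on `b ∈ span S`, then on `n ∈ span T`
    induction hb using Submodule.span_induction generalizing n with
    | mem b hbS =>
      induction hn using Submodule.span_induction with
      | mem n hnT =>
        exact Submodule.subset_span (by
          rw [Finset.coe_image]
          exact ⟨(b, n), by simp [hbS, hnT], rfl⟩)
      | zero => rw [smul_zero]; exact P.zero_mem
      | add x y _ _ hx hy => rw [smul_add]; exact P.add_mem hx hy
      | smul k x _ hx => rw [smul_comm]; exact P.smul_mem k hx
    | zero => rw [zero_smul]; exact P.zero_mem
    | add b c _ _ hb hc => rw [add_smul]; exact P.add_mem (hb n hn) (hc n hn)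
    | smul k b _ hb => rw [smul_assoc]; exact P.smul_mem k (hb n hn)
  have hge : P ≤ O' • L := by
    refine Submodule.span_le.mpr ?_
    rintro v hv
    rw [Finset.coe_image] at hv
    obtain ⟨⟨b, n⟩, hbn, rfl⟩ := hv
    rw [Finset.mem_coe, Finset.mem_product] at hbn
    exact Submodule.smul_mem_smul (hS ▸ Submodule.subset_span hbn.1) (hT ▸ Submodule.subset_span hbn.2)
  exact ⟨_, (le_antisymm hge hle)⟩

/-! ## Rem. 1.4.3.11 -/

/-- **Rem. 1.4.3.11, well-definedness of the Hecke translate, holds**: if `y = x·h′` with `h′ ∈ H′ ⊂ gHg⁻¹` then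
`y·g = (x·g)·(g⁻¹h′g)` with `g⁻¹h′g ∈ H`. [cite: Lan2013PELCompactifications, Rem. 1.4.3.11 (pp. 87–88)] -/
theorem Lan2013_14311_heckeTranslate_holds : Lan2013_14311_heckeTranslate.{u, v} := by
  intro G X _ _ H H' g hH' x y ⟨h', hh', hy⟩
  refine ⟨g⁻¹ * h' * g, (hH' h' hh').2, ?_⟩
  subst hy
  rw [← mul_smul, ← mul_smul, ← MulOpposite.op_mul, ← MulOpposite.op_mul]
  congr 2
  group

end Literature.AlgebraicGeometry.ModuliOfAbelianVarieties.Lan2013.Sec142to144IsogenyClasses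

end
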